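import Summits.HodgeConjecture.HodgeConjecture.Theorems.LinearSystemTorelliMiddleDivisorSupportCh0NullWeilSector
import HarnessLib.Audit

/-!
# Line `ch0-null-correspondence-support` — crux stmt-HodgeConjecture-1081 `LinearSystemTorelli.MiddleDivisorSupport`

crux-plan (opening), planner-cruxplan-stmt-HodgeConjecture-1081-ch0-null-corresponde-0, 2026-08-17.
Idea card `Cruxes/MiddleDivisorSupport/Ideas/ch0-null-correspondence-support.md` (crux-ideate r2 k5;
triage r2: pass 3/3 — TRIAGE-r2-1/2/3). Line card `Lines/ch0-null-correspondence-support.md`.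

## The lever (reverse Bloch–Srinivas)

If an algebraic self-correspondence `Z ∈ Z_{2p}(X × X)` of a smooth projective `X^{2p}` FIXES the middle
Hodge class `c` up to a positive multiple (`[Z]^* c = m c`) and is CH₀-NULL (its Chow action kills the
class of every closed point, up to one positive integer), then Bloch–Srinivas (Voisin II Cor. 10.20 with
`X₁′ = ∅`, tree fact `Motives.BlochSrinivas1983_correspondence_nullOnPoints`) gives `N Z ∼_rat Z″` with
`Z″` supported in `T × X`, `T ⊊ X` Zariski closed, hence (Voisin II (10.8), tree
`CorrespondenceAction.act_mem_supportedClasses` / `corrAct_mem_supportedClasses`) `m c = [Z]^* c ∈ N_T ⊆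
N¹H^{2p} = supportedClasses X (2p) 1` — the crux for `(X, c)`. The divisor `T` is an OUTPUT.

## The skeleton (6 registered stubs; every composition kernel-checked, `sorry` only inside `stub_*`)

∀X ATTACH FRAME (registered composition `MiddleDivisorSupport_of : F1 → F2 → F3 → MiddleDivisorSupport`,
the crux BY NAME):
* `stub_correspondencePackagesExist` (F1, construction debt, theorems in print): every smooth projective
  `X^{2p}` carries a Chow action `Act` (Fulton Def. 16.1.2) and a cohomological action `C` (Voisin II
  (10.7)) forming an `IsCorrespondencePackage`: (K1) Bloch–Srinivas Cor. 10.20 for `Act` (the named fact,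
  by name), (K2) POWERS `Z^{∘N}` with the `N`-th power action on every `Hʳ` and on point classes
  (Fulton Prop. 16.1.1 (a), Cor. 16.1.2, Ex. 19.2.7), (K3) GRAPHS `Γ_f` with `[Γ_f]^* = f^*` and
  `(Γ_f)_* {P} = {f P}` (Fulton Prop. 16.1.2 (c)). ONE action pair is taken for the whole line and pinned
  by (K2)/(K3) — the triage panel's "pin the action" repair of the ideator's `∀ Γ` typing.
* `stub_hodgeIsolatingCorrespondence` (F2 = HP, open off the endomorphism sectors, theorem on CM/Weil-type
  abelian varieties): for every package and every rational `(p,p)` class `c`, some cycle `Z` has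
  `[Z]^* c = m c` (`m ≥ 1`) and `[Z]^*` kills every class of type `(q, 0)`, all `q ≥ 0`.
* `stub_generalizedBlochNilpotence` (F3 = GB₀, Voisin II Conj. 11.22 for self-correspondences, nilpotent
  form): a cycle whose `[Z]^*` kills all `(q,0)`-classes acts nilpotently on point classes up to ONE
  positive integer: `M (Z_*)^N {P} = 0` for all `P ∈ X(ℂ)`.
Glue (proved): `W = Z^{∘N}` (K2) is CH₀-null up to `M`, Bloch–Srinivas (K1) puts `[W]^* c = m^N c` in
`N¹`, divide by `M m^N`.

WEIL-TYPE SECTOR (composition `weilClassSupport_of : F1 → S1 → S2 → S3 → WeilClassSupport`, where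
`WeilClassSupport` = the crux restricted to the rational `(n,n)` classes of the Weil plane
`weilClassesOf A φ n d` of an abelian `2n`-fold with `φ² = -d` — a ready `--supports stmt-1081` target;
`n = 2` is Markman 2025, `n ≥ 3` open):
* `stub_weilProjectorCoefficients` (S1, pure algebra, provable, M): integers `q(x,y)`, `m ≥ 1` with
  `Σ q(x,y)(x + yi√d)ᵃ(x - yi√d)ᵇ = m·𝟙_{{(2n,0),(0,2n)}}(a,b)` on `0 ≤ a,b ≤ 2n` — so `Z_q := Σ q Γ_{x·𝟙+y·φ}`
  is `m` times the `K`-type projector onto the Weil plane (HP on the sector is an explicit `ℤ`-combination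
  of graphs of complex multiplications; `corrAct_weilProjector_eq_smul` PROVES `[Z_q]^* c = m c` on `W`).
* `stub_weilProjectorNormalForm_of_bloch` (S2; reshape r1 by lead a1: GIVEN the lean `BlochPontryaginVanishing`
  = Bloch 1976 `I^{⋆(2n+1)} = 0` on `(P, φP)`, the rest is pure algebra in `ℤ[s,t]`, provable, M–L):
  `M₁ · Σ q(x,y){(x·𝟙 + y·φ)P} = M₂ · W_{2n}(P)` in `CH₀(A)`, `W_{2n}(P)` the Weil–Pontryagin class
  (`ℓ′^{⋆2n} + ℓ″^{⋆2n}` in rational form: `Σᵢ (-1)ⁱ C(2n,2i) d^{n-i} u^{⋆(2n-2i)} ⋆ v^{⋆2i}`, expanded into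
  point classes `{i·P + j·φ(P)}`).
* `stub_weilPontryaginIdentity` (S3 = (V1_{2n}), the HARDEST stub; theorem for `n ≤ 2`, open from `n = 3`):
  on balanced Weil type, `M · W_{2n}(P) = 0` for one `M ≥ 1` and all `P` — "`CH₀(det_K h¹(A)) = 0`".
Glue (proved): by (K3) `(Z_q)_* {P} = Σ q {(x·𝟙+y·φ)P}`, so S2 ∧ S3 make `Z_q` CH₀-null up to `M·M₁`
(`weilProjector_chowAct_null` — GB₀ for the projector, `generalizedBlochNilpotence_weilProjector`);
balancedness comes from the class itself (Deligne–Milne Prop. 4.4, tree `finrank_eq_of_mem_weilClassesOf`);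
Bloch–Srinivas as above.

Disproof used: none exists for this crux (no `Disproof.lean`, no `_false_without_`, no landed Negative
lemma; `ledger crux ls`, 2026-08-17); hypotheses of the crux honoured: rationality + type `(p,p)` enter F2
(a transcendental class is fixed by no correspondence killing `H^{2p,0}`) and, on the sector, the
balancedness S3 needs; projectivity throughout (cycles, Chow groups, Bloch–Srinivas); `2p = dim X`.
Negatives index (17744 MilnorK, 11121 Fermat K3, 12555 E-line): no contact.

## Status after cycle 1 (lead a1, 2026-08-17)

LANDED: route Defs (`Theorems/LinearSystemTorelliDefs.lean`, p152969 + p153253), S1 `stub_weilProjectorCoefficients`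
(p155080), S2 `stub_weilProjectorNormalForm_of_bloch` (p161003), the sector's lean discharged from the Literature
fact `Motives.Bloch1976_pontryaginPower_eq_zero` (p163381) by `blochPontryaginVanishing_of_bloch1976` (p163820),
the frame composition `middleDivisorSupport_of_frame` (`Theorems/…Ch0NullFrame.lean`, p163931) and the sector
composition `weilClassSupport_of_packages_bloch1976_weilPontryagin` (`Theorems/…Ch0NullWeilSector.lean`). All glue
lemmas of the original skeleton now live in those two Theorems files; this workfile keeps only the stubs and
the compositions BY NAME. OPEN: F1 (construction debt: no `CorrespondenceChowAction` instance in the tree),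
F2 (HC for `X × X`), F3 (Voisin II Conj. 11.22), S3 (open for `n ≥ 3`) — wave-1 audits in the lead's
`cycle1-report.md` (item evidence).

## Status after cycle 2 (lead c1, 2026-08-17) — waves 2 and 3, three `--supports` files ACCEPTED

* F1 `stub_correspondencePackagesExist`: wave 2 — stub-blocked on NO existing item / named fact: the blocker is
  the UNFILED construction of the intended `Motives.CorrespondenceChowAction` instance (Fulton Def. 16.1.2 via
  Ch. 6–8; `defn-CorrespondenceChowAction` was closed 2026-08-15 by the hypothesis structure itself, existence
  deliberately not a named fact, D-0026) + the unproved fact (K1) `BlochSrinivas1983_correspondence_nullOnPoints Act`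
  + cycle-level composition (K2). NEW: the cohomological half is constructible unconditionally
  (`exists_gysinFormalism_isGysinHodgeCompatible_complexOrientation_holds` + `GysinFormalism.correspondenceAction`),
  and its clause (K3)-for-`C` is LANDED: `Ch0Null.exists_correspondenceAction_graphs` (p168636, with the reusable
  `corrAct_primeCycle_graph : G.corrAct [Γ_f] = f^*`, `height_eq_of_isGenericPoint_graph`, …).
* F2 `stub_hodgeIsolatingCorrespondence`: wave 2 — stub-MISSTATED as typed: no field of `CorrespondenceAction`
  or of `IsCorrespondencePackage` ties `C.act r Z` to a cycle class, so neither "HC(X × X) ⟹ F2" nor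
  "Lefschetz (1,1) + Hodge index ⟹ F2 at p = 1" type-checks against the typed statement (the natural witnesses
  have unpinned `C.act`); corrected class-level form F2′ `HodgeIsolatingClass` on the tree's real
  `corrAction μ` (notes `work/stubs/F2-notes-c1.md`), PROVED at p = 1 and LANDED:
  `Ch0Null.hodgeIsolatingClass_surface` / `hodgeIsolatingClass_one` (p168920); general p: F2′ ⟸ the crux itself
  (HC(X) in degree 2p), so F2′ is at most crux-hard.
* F3 `stub_generalizedBlochNilpotence`: open conjecture (Voisin II Conj. 11.22); HARDNESS CERTIFICATE LANDED:
  `Ch0Null.uniformTorsion_pointClass_sub_of_frame` (p167607) — F1 ∧ F3 at p = 1 give Bloch's conjecture for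
  surfaces with p_g = q = 0 (uniform-torsion form; open for surfaces of general type), while the crux at p = 1 is
  Lefschetz (1,1) (`lefschetzOneOne_rational_holds`): the ∀X frame routes the crux through a STRICTLY HARDER
  statement at its only solved rung.
* S3 `stub_weilPontryaginIdentity` (lead): open for n ≥ 3 (Moonen 2011/2016 §8: "almost nothing seems known"
  about injectivity of the cycle map on `CH_{(0)}` / Bloch–Beilinson for abelian varieties beyond the
  divisor-generated subalgebra); the calibrations n ≤ 2 need Chow motives / Kimura nilpotence / Deninger–Murre,
  none of which exist on the tree's carriers (not even as hypothesis structures with instances).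
Sorries 4 → 4; no registered stub closed; the line's verdict is in the lead's `Lines/ch0-null-correspondence-support.dead.md`.
-/

noncomputable section

set_option linter.dupNamespace false

namespace Summit.HodgeConjecture.HodgeConjecture.Cruxes.MiddleDivisorSupport.Ch0NullCorrespondenceSupport

open CategoryTheory AlgebraicGeometry MonoidalCategory
open Literature.AlgebraicGeometry Literature.AlgebraicGeometry.HodgeTheory
open Literature.AlgebraicGeometry.Motives
open Literature.AlgebraicTopology.SingularHomology
open Summit.HodgeConjecture.HodgeConjecture.Theorems.Ch0Null
open scoped BigOperators

/-! ### The ∀X frame: the three stubs (statements and vocabulary = the landed route Defs, namespace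
`…Theorems.Ch0Null`; glue + composition = `Theorems/LinearSystemTorelliMiddleDivisorSupportCh0NullFrame.lean`) -/

/-- Audit-admissible heads for the hypotheses of `MiddleDivisorSupport_of`: `Stub.<stub name>` is a
reducible alias of the stub's statement, so the skeleton audit accepts the hypothesis BY NAME whichever
concluding theorem it inspects; the registered stub signatures stay the readable statement names. -/
abbrev Stub.stub_correspondencePackagesExist : Prop := CorrespondencePackagesExist
@[inherit_doc Stub.stub_correspondencePackagesExist]
abbrev Stub.stub_hodgeIsolatingCorrespondence : Prop := HodgeIsolatingCorrespondence
@[inherit_doc Stub.stub_correspondencePackagesExist]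
abbrev Stub.stub_generalizedBlochNilpotence : Prop := GeneralizedBlochNilpotence

/-- Stub F1 (construction debt, XL; frame): wave-1 audit — blocked on the construction of
`Motives.CorrespondenceChowAction (2p) X X` (Fulton Def. 16.1.2 = Ch. 6–8; no instance in the tree, no
junk witness) + `BlochSrinivas1983_correspondence_nullOnPoints` (K1) + composition of correspondences (K2);
the cohomological half is constructible relative to a `GysinFormalism`. [cite: Fulton1998, Def. 16.1.2 and Prop. 16.1.2 (c)] -/
theorem stub_correspondencePackagesExist : CorrespondencePackagesExist := by
  sorry

/-- Stub F2 = HP (open off the endomorphism sectors; frame): wave-1 audit — for the intended actions it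
is the Hodge conjecture for `X × X` in codimension `2p`; not junk-refutable; as typed (∀ packages) the
package pins `C.act` only on `ℤ`-combinations of graphs/powers, so it is derivable from the package axioms
only where `End(X)`-correspondences isolate the Hodge classes (the Weil/CM sector). [cite: VoisinHodgeII2003, Conj. 11.22] -/
theorem stub_hodgeIsolatingCorrespondence : HodgeIsolatingCorrespondence := by
  sorry

/-- Stub F3 = GB₀ (Voisin II Conj. 11.22 for self-correspondences; frame): wave-1 audit — open
(Bloch–Beilinson for `CH₀`, converse of Prop. 10.24; Kimura 2005 Prop. 7.5 in the finite-dimensional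
sector); not junk-refutable. [cite: VoisinHodgeII2003, Conj. 11.22] -/
theorem stub_generalizedBlochNilpotence : GeneralizedBlochNilpotence := by
  sorry

/-- **THE COMPOSITION: F1 → F2 → F3 → the crux, BY NAME** (landed as `Ch0Null.middleDivisorSupport_of_frame`,
p163931: powers `Z^{∘N}` + Bloch–Srinivas (K1) + Voisin II (10.8)). -/
theorem MiddleDivisorSupport_of (h₁ : Stub.stub_correspondencePackagesExist)
    (h₂ : Stub.stub_hodgeIsolatingCorrespondence) (h₃ : Stub.stub_generalizedBlochNilpotence) :
    Summit.HodgeConjecture.HodgeConjecture.Theses.LinearSystemTorelli.MiddleDivisorSupport :=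
  middleDivisorSupport_of_frame h₁ h₂ h₃

/-- The crux from the three frame stubs as they stand (depends on their `sorry`s; shows the frame closes). -/
theorem MiddleDivisorSupport_of_stubs :
    Summit.HodgeConjecture.HodgeConjecture.Theses.LinearSystemTorelli.MiddleDivisorSupport :=
  MiddleDivisorSupport_of stub_correspondencePackagesExist stub_hodgeIsolatingCorrespondence
    stub_generalizedBlochNilpotence

/-- **The same composition against the `NodalSupport` copy of the shared crux decl** (definitionally
equal statements; landed as `Ch0Null.nodalSupport_middleDivisorSupport_of_frame`). -/
theorem NodalSupport_MiddleDivisorSupport_of (h₁ : Stub.stub_correspondencePackagesExist)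
    (h₂ : Stub.stub_hodgeIsolatingCorrespondence) (h₃ : Stub.stub_generalizedBlochNilpotence) :
    Summit.HodgeConjecture.HodgeConjecture.Theses.NodalSupport.MiddleDivisorSupport :=
  nodalSupport_middleDivisorSupport_of_frame h₁ h₂ h₃


/-! ### The Weil-type SECTOR (vocabulary and statements = route Defs; glue + composition =
`Theorems/LinearSystemTorelliMiddleDivisorSupportCh0NullWeilSector.lean`; the lean `BlochPontryaginVanishing`
= Bloch 1976 Thm. 0.1 on `(P, φP)` is DISCHARGED from the Literature fact `Motives.Bloch1976_pontryaginPower_eq_zero`) -/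

section WeilSector

/-- Stub S1 — LANDED (wave 1, p155080: Vandermonde coefficient extraction on the grid `[0,4n]²`).
[cite: vanGeemen1994HodgeAV, proof of Thm. 6.12] -/
theorem stub_weilProjectorCoefficients : WeilProjectorCoefficients :=
  Summit.HodgeConjecture.HodgeConjecture.Theorems.Ch0Null.stub_weilProjectorCoefficients

/-- Stub S2 — LANDED (wave 1, p161003: pure algebra in `ℤ[s,t]` given the lean; `M₁ = 2^{2n-1}dⁿ(2n)!`,
`M₂ = m`). [cite: Bloch1976, Thm. 0.1] [cite: Beauville1986, Thm.] -/
theorem stub_weilProjectorNormalForm_of_bloch : BlochPontryaginVanishing → WeilProjectorNormalForm :=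
  Summit.HodgeConjecture.HodgeConjecture.Theorems.Ch0Null.stub_weilProjectorNormalForm_of_bloch

/-- The lean, discharged (p163820): Bloch 1976 Thm. 0.1 / Voisin II Thm. 11.29 ⟹ `BlochPontryaginVanishing`.
[cite: Bloch1976, Thm. 0.1] -/
theorem blochPontryaginVanishing (hB : Bloch1976_pontryaginPower_eq_zero) : BlochPontryaginVanishing :=
  blochPontryaginVanishing_of_bloch1976 hB

/-- Stub S3 = (V1_{2n}) — the HARDEST stub (theorem `n ≤ 2` via HC(W) + O'Sullivan + Kimura + Roitman,
none of them on the tree's carriers; OPEN for `n ≥ 3`; Markman 2025 covers sixfolds of discriminant `-1`).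
[cite: Moonen2016, Thm. 1] -/
theorem stub_weilPontryaginIdentity : WeilPontryaginIdentity := by
  sorry

/-- Sanity: the sector target is a restriction of the crux (landed: `Ch0Null.weilClassSupport_of_middleDivisorSupport`). -/
theorem weilClassSupport_of_crux
    (h : Summit.HodgeConjecture.HodgeConjecture.Theses.LinearSystemTorelli.MiddleDivisorSupport) :
    WeilClassSupport :=
  weilClassSupport_of_middleDivisorSupport h

/-- **THE SECTOR COMPOSITION: F1 ∧ Bloch 1976 ∧ S3 ⟹ `WeilClassSupport`**, S1 and S2 discharged (landed as
`Ch0Null.weilClassSupport_of_packages_bloch1976_weilPontryagin`). [cite: VoisinHodgeII2003, Cor. 10.20 and (10.8)] -/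
theorem weilClassSupport_of (h₁ : CorrespondencePackagesExist) (hB : Bloch1976_pontryaginPower_eq_zero)
    (s₃ : WeilPontryaginIdentity) : WeilClassSupport :=
  weilClassSupport_of_packages_bloch1976_weilPontryagin h₁ hB s₃

/-- The crux's Weil-class instance, closed modulo exactly F1, S3 as they stand and the named fact
`Bloch1976_pontryaginPower_eq_zero` (Bloch 1976 Thm. 0.1). -/
theorem weilClassSupport_of_stubs (hB : Bloch1976_pontryaginPower_eq_zero) : WeilClassSupport :=
  weilClassSupport_of stub_correspondencePackagesExist hB stub_weilPontryaginIdentity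

end WeilSector

end Summit.HodgeConjecture.HodgeConjecture.Cruxes.MiddleDivisorSupport.Ch0NullCorrespondenceSupport

end
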